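import Literature.AlgebraicGeometry.Modules.CechFullCochainRawDegreeTwo
import Literature.AlgebraicGeometry.Morphisms.CechH1
import Literature.Algebra.Homology.OrderedCechSystemMap
import HarnessLib

/-!
# Raw (all ordered pairs) versus ORDERED module Čech `1`-cochains of `𝒪_X`: restriction and alternating extension
# (The Stacks Project, Tags 01FG, 01FM, 01ED)

Topic `AlgebraicGeometry/Modules`; namespace `Literature.AlgebraicGeometry.Modules`.  Three small DEFINITIONS (additive maps, with unfolding
lemmas) and theorems; no named fact, no instance, no notation, no `sorry`.  Cell `hodgecm-mathlib` (D-0151), P6 «MOD programme», junction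
(J10-iv) of the «H1-DIM-ANY-CHAR cut» (B-p04 (g42), memo `MEMO-H1DIM-cut.v4`), FILE 1a; the sequel `Modules/CechComplexHOneCechH1` assembles
the comparison of the two degree-one Čech currencies of the tree —

* the ORDERED module Čech complex ★ `Modules.cechComplex 𝓤 (unitModule X) ρ` (`Modules/ModuleCechComplex`: one component per strictly increasing
  tuple, scalars through any `ρ : R → Γ(X, 𝒪_X)`; the currency of the Grothendieck-complex ∕ base-change files ★ `Modules/CechComplexBaseChangeHmkQ`,
  ★ `Modules/CechComplexTorsionOffBasicOpen`);
* the ALL-ORDERED-PAIRS cochains ★ `Morphisms.CechC0∕CechC1∕CechC2 f 𝓤` of an `A`-scheme `f : X → Spec A` (`Morphisms/CechH1`; the currency of ★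
  `cechH1_finite_holds`, ★ `CechH1AffineCoverIndependence`, ★ `CechH1FlatBaseChangeRank` and of the abelian-variety count `dim Ȟ¹(A, 𝒪_A) = dim A`).

For EVERY scheme `X` and every family of opens `𝓤` on a linearly ordered index type (no affineness, no covering condition):
* §0 plumbing (restriction along equal opens, the opens `U_{ {i,j} }`, `U_{ {i,j,k} }`, `toRing` on the terms of the system, `1`-∕`2`-simplices);
* §1 `vertexRestrict`, **`edgeRestrict`** (raw `0`-∕`1`-cochains ↦ ordered ones: keep the increasing pairs) with `edgeRestrict_cechD0` (a cochain map in
  degree `0 → 1`), `sysD_edgeRestrict_eq_zero` (cocycles to cocycles) and `edgeRestrict_smul` (`σ`-semilinearity for `σ : A → R` with `ρ ∘ σ = f♯`);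
* §2 **`edgeExtend`** (the alternating extension `c_{ij} = y_{ij}|`, `c_{ji} = -y_{ij}|`, `c_{ii} = 0` [StacksProject, Tag 01FM]) with
  `edgeRestrict_edgeExtend : edgeRestrict ∘ edgeExtend = id` and `edgeExtend_edgeRestrict : edgeExtend ∘ edgeRestrict = id` ON COCYCLES (a raw
  `1`-cocycle has `c_{ii} = 0` and `c_{ij}| = -c_{ji}|`: `apply_self_eq_zero_of_cechD1_eq_zero`, `res_add_res_eq_zero_of_cechD1_eq_zero`).

HC_CM is proved only modulo the printed citations until rung 0 closes; nothing here is about HC (count-neutral ★ capital).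

## References
* [StacksProject] The Stacks Project, Tag 01FG and Tag 01FM (ordered∕alternating versus full Čech complex), Tag 01ED (Čech cohomology).
* [GortzWedhorn2023] U. Görtz, T. Wedhorn, *Algebraic Geometry II* (2023), Def. 21.64 (p. 179), Def. 21.68 (p. 180), Thm. 22.9 (p. 236).
* [Hartshorne1977] R. Hartshorne, *Algebraic Geometry* (1977), III §4, Lemma 4.4 and Thm. 4.5 (pp. 220–222).
-/

noncomputable section

set_option backward.isDefEq.respectTransparency false -- `ModuleCat`-valued functors (as in ★ `OrderedCechSystem`)

open CategoryTheory AlgebraicGeometry TopologicalSpace Opposite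
open Literature.Algebra.Homology Literature.Algebra.Homology.OrderedCech Literature.AlgebraicGeometry.Morphisms

universe u

namespace Literature.AlgebraicGeometry.Modules

/-! ## §0 Plumbing -/

section Plumbing

variable {X : Scheme.{u}} {ι : Type} [LinearOrder ι] (U : ι → X.Opens)

omit [LinearOrder ι] in
/-- Composite restrictions of functions (a private copy of ★ `Motives.RatFn.res_res`, to keep the import closure small). [folklore] -/
private theorem resΓ_comp {V₁ V₂ V₃ : X.Opens} (h₁ : V₂ ≤ V₁) (h₂ : V₃ ≤ V₂) (x : Γ(X, V₁)) :
    X.presheaf.map (homOfLE h₂).op (X.presheaf.map (homOfLE h₁).op x) = X.presheaf.map (homOfLE (h₂.trans h₁)).op x := by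
  rw [← CommRingCat.comp_apply, ← Functor.map_comp]
  rfl

omit [LinearOrder ι] in
/-- Restriction along `V ≤ V` is the identity (a private copy of ★ `Motives.CartierDivisor.map_homOfLE_refl`). [folklore] -/
private theorem resΓ_refl {V : X.Opens} (h : V ≤ V) (x : Γ(X, V)) : X.presheaf.map (homOfLE h).op x = x := by
  rw [show homOfLE h = 𝟙 V from Subsingleton.elim _ _, op_id, X.presheaf.map_id]
  rfl

omit [LinearOrder ι] in
/-- Restriction along `W ≤ V ≤ W` (equal opens) is the identity. [cite: GortzWedhorn2023, Def. 21.64 (p. 179)] -/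
theorem resΓ_comp_self {V W : X.Opens} (h₁ : W ≤ V) (h₂ : V ≤ W) (x : Γ(X, V)) :
    X.presheaf.map (homOfLE h₂).op (X.presheaf.map (homOfLE h₁).op x) = x := by
  rw [resΓ_comp, resΓ_refl]

omit [LinearOrder ι] in
/-- Restriction along `W ≤ V` with `V ≤ W` (equal opens) is injective. [cite: GortzWedhorn2023, Def. 21.64 (p. 179)] -/
theorem resΓ_injective_of_ge {V W : X.Opens} (h₁ : W ≤ V) (h₂ : V ≤ W) :
    Function.Injective (X.presheaf.map (homOfLE h₁).op : Γ(X, V) → Γ(X, W)) := fun x y hxy => by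
  rw [← resΓ_comp_self h₁ h₂ x, ← resΓ_comp_self h₁ h₂ y, hxy]

/-- `U_{ {i,j} } ≤ U_i ∩ U_j`. [cite: GortzWedhorn2023, Def. 21.64 (p. 179)] -/
theorem cechOpen_pair_le_inf (i j : ι) : cechOpen U {i, j} ≤ U i ⊓ U j :=
  le_inf (cechOpen_le U (by simp)) (cechOpen_le U (by simp))

/-- `U_i ∩ U_j ≤ U_{ {i,j} }`. [cite: GortzWedhorn2023, Def. 21.64 (p. 179)] -/
theorem inf_le_cechOpen_pair' (i j : ι) : U i ⊓ U j ≤ cechOpen U {i, j} :=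
  Finset.le_inf fun l hl => by
    rcases Finset.mem_insert.1 hl with rfl | hl
    · exact inf_le_left
    · rw [Finset.mem_singleton.1 hl]; exact inf_le_right

/-- `U_{ {i,j,k} } ≤ U_i ∩ U_j ∩ U_k`. [cite: GortzWedhorn2023, Def. 21.64 (p. 179)] -/
theorem cechOpen_triple_le_inf (i j k : ι) : cechOpen U {i, j, k} ≤ U i ⊓ U j ⊓ U k :=
  le_inf (le_inf (cechOpen_le U (by simp)) (cechOpen_le U (by simp))) (cechOpen_le U (by simp))

/-- `U_i ∩ U_j ∩ U_k ≤ U_{ {i,j,k} }`. [cite: GortzWedhorn2023, Def. 21.64 (p. 179)] -/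
theorem inf_le_cechOpen_triple' (i j k : ι) : U i ⊓ U j ⊓ U k ≤ cechOpen U {i, j, k} :=
  Finset.le_inf fun l hl => by
    rcases Finset.mem_insert.1 hl with rfl | hl
    · exact inf_le_left.trans inf_le_left
    rcases Finset.mem_insert.1 hl with rfl | hl
    · exact inf_le_left.trans inf_le_right
    · rw [Finset.mem_singleton.1 hl]; exact inf_le_right

/-- The minimum of `{a, b}` (`a < b`) is `a` (the first vertex of the `1`-simplex `{a < b}`). [cite: GortzWedhorn2023, Def. 21.68 (p. 180)] -/
theorem min'_pair {a b : ι} (hab : a < b) (h : ({a, b} : Finset ι).Nonempty) : ({a, b} : Finset ι).min' h = a := by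
  refine le_antisymm (Finset.min'_le _ _ (by simp)) (Finset.le_min' _ _ _ fun y hy => ?_)
  rcases Finset.mem_insert.1 hy with rfl | hy
  · exact le_rfl
  · rw [Finset.mem_singleton.1 hy]; exact hab.le

/-- The maximum of `{a, b}` (`a < b`) is `b` (the last vertex of the `1`-simplex `{a < b}`). [cite: GortzWedhorn2023, Def. 21.68 (p. 180)] -/
theorem max'_pair {a b : ι} (hab : a < b) (h : ({a, b} : Finset ι).Nonempty) : ({a, b} : Finset ι).max' h = b := by
  refine le_antisymm (Finset.max'_le _ _ _ fun y hy => ?_) (Finset.le_max' _ _ (by simp))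
  rcases Finset.mem_insert.1 hy with rfl | hy
  · exact hab.le
  · rw [Finset.mem_singleton.1 hy]

/-- `U_σ ≤ U_{min σ} ∩ U_{max σ}` for a simplex `σ`. [cite: GortzWedhorn2023, Def. 21.64 (p. 179)] -/
theorem cechOpen_le_inf_min'_max' {n : ℤ} (σ : Simplex ι n) :
    cechOpen U σ.1 ≤ U (σ.1.min' σ.2.1) ⊓ U (σ.1.max' σ.2.1) :=
  le_inf (cechOpen_le U (Finset.min'_mem _ _)) (cechOpen_le U (Finset.max'_mem _ _))

/-- `U_σ ≤ U_{min σ}` for a simplex `σ`. [cite: GortzWedhorn2023, Def. 21.64 (p. 179)] -/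
theorem cechOpen_le_min' {n : ℤ} (σ : Simplex ι n) : cechOpen U σ.1 ≤ U (σ.1.min' σ.2.1) :=
  cechOpen_le U (Finset.min'_mem _ _)

omit U in
/-- Every `2`-simplex is `{i < j < k}`. [folklore] [cite: GortzWedhorn2023, Def. 21.68 (p. 180)] -/
theorem exists_eq_triple_of_simplex_two (σ : Simplex ι 2) :
    ∃ i j k : ι, ∃ (_ : i < j) (_ : j < k), σ.1 = {i, j, k} := by
  have hcard : σ.1.card = 3 := by have := σ.2.2; omega
  obtain ⟨i, j, k, hij, hik, hjk, hs⟩ := Finset.card_eq_three.1 hcard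
  have key : ∀ a b c : ι, (∀ x, x ∈ ({a, b, c} : Finset ι) ↔ x ∈ ({i, j, k} : Finset ι)) →
      a < b → b < c → ∃ i j k : ι, ∃ (_ : i < j) (_ : j < k), σ.1 = {i, j, k} :=
    fun a b c h h1 h2 => ⟨a, b, c, h1, h2, hs.trans (Finset.ext fun x => (h x).symm)⟩
  have mem3 : ∀ a b c x : ι, x ∈ ({a, b, c} : Finset ι) ↔ x = a ∨ x = b ∨ x = c := fun a b c x => by
    simp only [Finset.mem_insert, Finset.mem_singleton]
  rcases lt_trichotomy i j with h1 | h1 | h1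
  · rcases lt_trichotomy j k with h2 | h2 | h2
    · exact key i j k (fun x => Iff.rfl) h1 h2
    · exact absurd h2 hjk
    · rcases lt_trichotomy i k with h3 | h3 | h3
      · exact key i k j (fun x => by rw [mem3, mem3]; tauto) h3 h2
      · exact absurd h3 hik
      · exact key k i j (fun x => by rw [mem3, mem3]; tauto) h3 h1
  · exact absurd h1 hij
  · rcases lt_trichotomy i k with h3 | h3 | h3
    · exact key j i k (fun x => by rw [mem3, mem3]; tauto) h1 h3
    · exact absurd h3 hik
    · rcases lt_trichotomy j k with h2 | h2 | h2
      · exact key j k i (fun x => by rw [mem3, mem3]; tauto) h2 h3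
      · exact absurd h2 hjk
      · exact key k j i (fun x => by rw [mem3, mem3]; tauto) h2 h1

variable (L : X.Modules) {R : Type u} [CommRing R] (ρ : R →+* Γ(X, ⊤))

/-- The first differential of the module Čech complex is `sysD 0`. [cite: GortzWedhorn2023, Def. 21.68 (p. 180)] -/
theorem cechComplex_d_zero_one_apply (g : OrderedCech.SysCochain (sectionsSystem U L ρ) 0) :
    ((cechComplex U L ρ).d 0 1).hom g = OrderedCech.sysD (sectionsSystem U L ρ) 0 g := by
  have h := OrderedCech.sysComplex_d (sectionsSystem U L ρ) 0
  exact congrArg (fun φ => (ModuleCat.Hom.hom φ) g) h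

/-- The second differential of the module Čech complex is `sysD 1`. [cite: GortzWedhorn2023, Def. 21.68 (p. 180)] -/
theorem cechComplex_d_one_two_apply (g : OrderedCech.SysCochain (sectionsSystem U L ρ) 1) :
    ((cechComplex U L ρ).d 1 2).hom g = OrderedCech.sysD (sectionsSystem U L ρ) 1 g := by
  have h := OrderedCech.sysComplex_d (sectionsSystem U L ρ) 1
  exact congrArg (fun φ => (ModuleCat.Hom.hom φ) g) h

omit [LinearOrder ι] in
/-- `toRing` of a sum in a term `Γ(𝒪_X, U_s)` of the system. [cite: GortzWedhorn2023, Def. 21.68 (p. 180)] -/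
theorem toRing_obj_add (s : Finset ι) (x y : (sectionsSystem U (unitModule X) ρ).obj s) :
    SecMod.toRing ρ (x + y) = SecMod.toRing ρ x + SecMod.toRing ρ y := rfl

omit [LinearOrder ι] in
/-- `toRing` of a difference in a term of the system. [cite: GortzWedhorn2023, Def. 21.68 (p. 180)] -/
theorem toRing_obj_sub (s : Finset ι) (x y : (sectionsSystem U (unitModule X) ρ).obj s) :
    SecMod.toRing ρ (x - y) = SecMod.toRing ρ x - SecMod.toRing ρ y :=
  SecMod.toRing_sub ρ x y

omit [LinearOrder ι] in
/-- `toRing` of a negation in a term of the system. [cite: GortzWedhorn2023, Def. 21.68 (p. 180)] -/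
theorem toRing_obj_neg (s : Finset ι) (x : (sectionsSystem U (unitModule X) ρ).obj s) :
    SecMod.toRing ρ (-x) = -SecMod.toRing ρ x :=
  SecMod.toRing_neg ρ x

omit [LinearOrder ι] in
/-- `toRing 0 = 0` in a term of the system. [cite: GortzWedhorn2023, Def. 21.68 (p. 180)] -/
theorem toRing_obj_zero (s : Finset ι) : SecMod.toRing ρ (0 : (sectionsSystem U (unitModule X) ρ).obj s) = 0 := rfl

omit [LinearOrder ι] in
/-- The scalar action through `ρ` on a term of the system: multiplication by `ρ(r)|_{U_s}`. [cite: GortzWedhorn2023, Def. 21.68 (p. 180)] -/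
theorem toRing_obj_smul (s : Finset ι) (r : R) (x : (sectionsSystem U (unitModule X) ρ).obj s) :
    SecMod.toRing ρ (r • x) = X.presheaf.map (homOfLE (le_top : cechOpen U s ≤ ⊤)).op (ρ r) * SecMod.toRing ρ x := rfl

end Plumbing

/-! ## §1 Restriction of raw cochains to increasing tuples -/

section Restrict

variable {A : Type u} [CommRing A] {X : Scheme.{u}} (f : X ⟶ Spec (.of A))
  {R : Type u} [CommRing R] (ρ : R →+* Γ(X, ⊤)) {ι : Type} [LinearOrder ι] (U : ι → X.Opens)

/-- **Restriction of raw `0`-cochains to vertices**: `(b_i)_i ↦ (b_{min σ}|_{U_σ})_σ`. [cite: StacksProject, Tag 01FG] -/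
def vertexRestrict : CechC0 f U →+ OrderedCech.SysCochain (sectionsSystem U (unitModule X) ρ) 0 :=
  AddMonoidHom.mk' (fun b σ => SecMod.ofRing ρ (X.presheaf.map (homOfLE (cechOpen_le_min' U σ)).op (b (σ.1.min' σ.2.1))))
    fun b b' => by
      funext σ
      apply SecMod.toRing_injective ρ
      change X.presheaf.map _ (b _ + b' _) = X.presheaf.map _ (b _) + X.presheaf.map _ (b' _)
      rw [map_add]

/-- **Restriction of raw `1`-cochains to increasing pairs**: `(c_{ij})_{i,j} ↦ (c_{min σ, max σ}|_{U_σ})_σ`. [cite: StacksProject, Tag 01FG] -/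
def edgeRestrict : CechC1 f U →+ OrderedCech.SysCochain (sectionsSystem U (unitModule X) ρ) 1 :=
  AddMonoidHom.mk' (fun c σ => SecMod.ofRing ρ
      (X.presheaf.map (homOfLE (cechOpen_le_inf_min'_max' U σ)).op (c (σ.1.min' σ.2.1) (σ.1.max' σ.2.1))))
    fun c c' => by
      funext σ
      apply SecMod.toRing_injective ρ
      change X.presheaf.map _ (c _ _ + c' _ _) = X.presheaf.map _ (c _ _) + X.presheaf.map _ (c' _ _)
      rw [map_add]

/-- `vertexRestrict` at the vertex `{i}`. [cite: StacksProject, Tag 01FG] -/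
theorem toRing_vertexRestrict_vertex (b : CechC0 f U) (i : ι) :
    SecMod.toRing ρ (vertexRestrict f ρ U b (vertex i)) =
      Sections.res f (cechOpen_le U (Finset.mem_singleton_self i) : cechOpen U {i} ≤ U i) (b i) := by
  have key : ∀ (i' : ι) (h : cechOpen U {i} ≤ U i') (h' : cechOpen U {i} ≤ U i), i' = i →
      X.presheaf.map (homOfLE h).op (b i') = Sections.res f h' (b i) := by
    rintro i' h h' rfl; rfl
  exact key _ _ _ (Finset.min'_singleton i)

/-- `edgeRestrict` at the edge `{a < b}`: `c_{ab}|_{U_{ {a,b} }}`. [cite: StacksProject, Tag 01FG] -/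
theorem toRing_edgeRestrict_edge (c : CechC1 f U) (a b : ι) (hab : a < b) :
    SecMod.toRing ρ (edgeRestrict f ρ U c (edge a b hab)) = Sections.res f (cechOpen_pair_le_inf U a b) (c a b) := by
  have key : ∀ (i j : ι) (h : cechOpen U {a, b} ≤ U i ⊓ U j) (h' : cechOpen U {a, b} ≤ U a ⊓ U b), i = a → j = b →
      X.presheaf.map (homOfLE h).op (c i j) = Sections.res f h' (c a b) := by
    rintro i j h h' rfl rfl; rfl
  exact key _ _ _ _ (min'_pair hab _) (max'_pair hab _)

/-- **Semilinearity**: for `σ : A → R` with `ρ ∘ σ = f♯`, `edgeRestrict (a • c) = σ(a) • edgeRestrict c`.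
[cite: GortzWedhorn2023, Def. 21.68 (p. 180)] -/
theorem edgeRestrict_smul (σ : A →+* R) (hσ : ∀ a, ρ (σ a) = algebraMapΓ f a) (a : A) (c : CechC1 f U) :
    edgeRestrict f ρ U (a • c) = σ a • edgeRestrict f ρ U c := by
  funext τ
  apply SecMod.toRing_injective ρ
  change X.presheaf.map _ ((a • c) _ _) = SecMod.toRing ρ (σ a • edgeRestrict f ρ U c τ)
  rw [SecMod.toRing_smul, Pi.smul_apply, Pi.smul_apply, Algebra.smul_def, map_mul, Sections.algebraMap_apply, ← hσ]
  change X.presheaf.map _ (X.presheaf.map _ (ρ (σ a))) * _ = toSections ρ _ (σ a) * X.presheaf.map _ (c _ _)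
  rw [resΓ_comp]
  rfl

/-- **`edgeRestrict` is a cochain map in degree `0 → 1`**: `edgeRestrict (d⁰ b) = d (vertexRestrict b)`. [cite: StacksProject, Tag 01FG] -/
theorem edgeRestrict_cechD0 (b : CechC0 f U) :
    edgeRestrict f ρ U (cechD0 f U b) = OrderedCech.sysD (sectionsSystem U (unitModule X) ρ) 0 (vertexRestrict f ρ U b) := by
  funext τ
  obtain ⟨i, j, hij, rfl⟩ := exists_eq_edge τ
  apply SecMod.toRing_injective ρ
  rw [toRing_edgeRestrict_edge, OrderedCech.sysD_edge, toRing_obj_sub, toRing_sectionsSystem_map, toRing_sectionsSystem_map,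
    toRing_vertexRestrict_vertex, toRing_vertexRestrict_vertex, ← Sections.res_apply f, ← Sections.res_apply f, Sections.res_res,
    Sections.res_res, cechD0_apply, map_sub, Sections.res_res, Sections.res_res]

/-- **`edgeRestrict` maps cocycles to cocycles**: `d (edgeRestrict c) = 0` if `d¹ c = 0`. [cite: StacksProject, Tag 01FM] -/
theorem sysD_edgeRestrict_eq_zero (c : CechC1 f U) (hc : cechD1 f U c = 0) :
    OrderedCech.sysD (sectionsSystem U (unitModule X) ρ) 1 (edgeRestrict f ρ U c) = 0 := by
  funext τ
  obtain ⟨i, j, k, hij, hjk, hτ⟩ := exists_eq_triple_of_simplex_two τ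
  have hik : i < k := hij.trans hjk
  apply SecMod.toRing_injective ρ
  rw [OrderedCech.sysD_one_apply_triple _ τ hij hjk hτ]
  -- the three edge values, pushed to `U_τ`
  have hsub : ∀ {p q : ι}, p ∈ τ.1 → q ∈ τ.1 → ({p, q} : Finset ι) ⊆ τ.1 := fun hp hq =>
    Finset.insert_subset hp (Finset.singleton_subset_iff.2 hq)
  have hi : i ∈ τ.1 := by rw [hτ]; simp
  have hj : j ∈ τ.1 := by rw [hτ]; simp
  have hk : k ∈ τ.1 := by rw [hτ]; simp
  have ev : ∀ (p q : ι) (hpq : p < q) (hp : p ∈ τ.1) (hq : q ∈ τ.1),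
      SecMod.toRing ρ ((edgeRestrict f ρ U c).ext0At {p, q} τ.1) =
        Sections.res f ((cechOpen_anti U (hsub hp hq)).trans (cechOpen_pair_le_inf U p q)) (c p q) := by
    intro p q hpq hp hq
    have h := OrderedCech.SysCochain.ext0At_val (edgeRestrict f ρ U c) (edge p q hpq) τ.1 (hsub hp hq)
    change SecMod.toRing ρ ((edgeRestrict f ρ U c).ext0At (edge p q hpq).1 τ.1) = _
    rw [h, toRing_sectionsSystem_map, toRing_edgeRestrict_edge]
    exact resΓ_comp _ _ _
  change SecMod.toRing ρ (_ - _ + _) = SecMod.toRing ρ 0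
  rw [toRing_obj_zero, toRing_obj_add, toRing_obj_sub, ev j k hjk hj hk, ev i k hik hi hk, ev i j hij hi hj]
  -- the raw cocycle identity at `(i, j, k)`, pushed to `U_τ`
  have hle : cechOpen U τ.1 ≤ U i ⊓ U j ⊓ U k := by rw [hτ]; exact cechOpen_triple_le_inf U i j k
  have key := congrArg (Sections.res f hle) (congr_fun (congr_fun (congr_fun hc i) j) k)
  rw [cechD1_apply, Pi.zero_apply, Pi.zero_apply, Pi.zero_apply, map_zero, map_add, map_sub, Sections.res_res, Sections.res_res,
    Sections.res_res] at key
  exact key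

end Restrict

/-! ## §2 The alternating extension of ordered `1`-cochains -/

section Extend

variable {A : Type u} [CommRing A] {X : Scheme.{u}} (f : X ⟶ Spec (.of A))
  {R : Type u} [CommRing R] (ρ : R →+* Γ(X, ⊤)) {ι : Type} [LinearOrder ι] (U : ι → X.Opens)

/-- `U_i ∩ U_j ≤ U_{ {j,i} }`. [cite: GortzWedhorn2023, Def. 21.64 (p. 179)] -/
theorem inf_le_cechOpen_pair_comm (i j : ι) : U i ⊓ U j ≤ cechOpen U {j, i} :=
  (le_inf inf_le_right inf_le_left).trans (inf_le_cechOpen_pair' U j i)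

/-- **The alternating extension of an ordered `1`-cochain to all ordered pairs**: `c_{ij} = y_{ij}|` (`i < j`), `c_{ji} = -y_{ij}|`
(`j < i`), `c_{ii} = 0`. [cite: StacksProject, Tag 01FM] -/
def edgeExtend : OrderedCech.SysCochain (sectionsSystem U (unitModule X) ρ) 1 →+ CechC1 f U :=
  AddMonoidHom.mk' (fun y i j =>
      if h : i < j then
        Sections.res f (inf_le_cechOpen_pair' U i j) ((Sections.equiv f (cechOpen U {i, j})).symm (SecMod.toRing ρ (y (edge i j h))))
      else if h' : j < i then
        -Sections.res f (inf_le_cechOpen_pair_comm U i j)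
          ((Sections.equiv f (cechOpen U {j, i})).symm (SecMod.toRing ρ (y (edge j i h'))))
      else 0)
    fun y y' => by
      funext i j
      dsimp only [Pi.add_apply]
      split_ifs with h h'
      · rw [← map_add, ← map_add, ← toRing_obj_add]; rfl
      · rw [← neg_add, ← map_add, ← map_add, ← toRing_obj_add]; rfl
      · rw [add_zero]

/-- `edgeExtend y` on an increasing pair. [cite: StacksProject, Tag 01FM] -/
theorem edgeExtend_apply_of_lt (y : OrderedCech.SysCochain (sectionsSystem U (unitModule X) ρ) 1) {i j : ι} (hij : i < j) :
    edgeExtend f ρ U y i j =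
      Sections.res f (inf_le_cechOpen_pair' U i j) ((Sections.equiv f (cechOpen U {i, j})).symm (SecMod.toRing ρ (y (edge i j hij)))) := by
  change (if h : i < j then _ else _) = _
  rw [dif_pos hij]

/-- `edgeExtend y` on a decreasing pair. [cite: StacksProject, Tag 01FM] -/
theorem edgeExtend_apply_of_gt (y : OrderedCech.SysCochain (sectionsSystem U (unitModule X) ρ) 1) {i j : ι} (hji : j < i) :
    edgeExtend f ρ U y i j =
      -Sections.res f (inf_le_cechOpen_pair_comm U i j) ((Sections.equiv f (cechOpen U {j, i})).symm (SecMod.toRing ρ (y (edge j i hji)))) := by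
  change (if h : i < j then _ else _) = _
  rw [dif_neg (lt_asymm hji), dif_pos hji]

/-- `edgeExtend y` vanishes on the diagonal. [cite: StacksProject, Tag 01FM] -/
theorem edgeExtend_apply_self (y : OrderedCech.SysCochain (sectionsSystem U (unitModule X) ρ) 1) (i : ι) :
    edgeExtend f ρ U y i i = 0 := by
  change (if h : i < i then _ else _) = _
  rw [dif_neg (lt_irrefl i), dif_neg (lt_irrefl i)]

/-- **`edgeRestrict ∘ edgeExtend = id`**. [cite: StacksProject, Tag 01FM] -/
theorem edgeRestrict_edgeExtend (y : OrderedCech.SysCochain (sectionsSystem U (unitModule X) ρ) 1) :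
    edgeRestrict f ρ U (edgeExtend f ρ U y) = y := by
  funext τ
  obtain ⟨a, b, hab, rfl⟩ := exists_eq_edge τ
  apply SecMod.toRing_injective ρ
  rw [toRing_edgeRestrict_edge, edgeExtend_apply_of_lt f ρ U y hab, Sections.res_res]
  exact resΓ_refl _ _

omit [LinearOrder ι] in
/-- The diagonal values of a raw `1`-cocycle vanish: `c_{ii} = 0`. [cite: StacksProject, Tag 01FM] -/
theorem apply_self_eq_zero_of_cechD1_eq_zero (c : CechC1 f U) (hc : cechD1 f U c = 0) (i : ι) : c i i = 0 := by
  have key := congr_fun (congr_fun (congr_fun hc i) i) i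
  rw [cechD1_apply, Pi.zero_apply, Pi.zero_apply, Pi.zero_apply,
    Sections.res_eq_res f _ (inf_le_left : U i ⊓ U i ⊓ U i ≤ U i ⊓ U i) (c i i),
    Sections.res_eq_res f (le_inf (inf_le_left.trans inf_le_left) inf_le_right) (inf_le_left : U i ⊓ U i ⊓ U i ≤ U i ⊓ U i) (c i i),
    sub_self, zero_add] at key
  apply resΓ_injective_of_ge (inf_le_left : U i ⊓ U i ⊓ U i ≤ U i ⊓ U i) (le_inf le_rfl inf_le_left)
  change Sections.res f _ (c i i) = Sections.res f _ 0
  rw [key, map_zero]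

omit [LinearOrder ι] in
/-- A raw `1`-cocycle is alternating: `c_{ij}| = -c_{ji}|` on `U_j ∩ U_i ∩ U_j`. [cite: StacksProject, Tag 01FM] -/
theorem res_add_res_eq_zero_of_cechD1_eq_zero (c : CechC1 f U) (hc : cechD1 f U c = 0) (i j : ι) :
    Sections.res f (le_inf (inf_le_left.trans inf_le_right) inf_le_right) (c i j) +
      Sections.res f (inf_le_left : U j ⊓ U i ⊓ U j ≤ U j ⊓ U i) (c j i) = 0 := by
  have key := congr_fun (congr_fun (congr_fun hc j) i) j
  rw [cechD1_apply, Pi.zero_apply, Pi.zero_apply, Pi.zero_apply, apply_self_eq_zero_of_cechD1_eq_zero f U c hc j, map_zero,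
    sub_zero] at key
  exact key

/-- **`edgeExtend ∘ edgeRestrict = id` on cocycles**: a raw `1`-cocycle is the alternating extension of its restriction to increasing pairs.
[cite: StacksProject, Tag 01FM] -/
theorem edgeExtend_edgeRestrict (c : CechC1 f U) (hc : cechD1 f U c = 0) : edgeExtend f ρ U (edgeRestrict f ρ U c) = c := by
  funext i j
  rcases lt_trichotomy i j with hij | rfl | hji
  · rw [edgeExtend_apply_of_lt f ρ U _ hij, toRing_edgeRestrict_edge]
    exact resΓ_comp_self _ _ _
  · rw [edgeExtend_apply_self, apply_self_eq_zero_of_cechD1_eq_zero f U c hc i]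
  · rw [edgeExtend_apply_of_gt f ρ U _ hji, toRing_edgeRestrict_edge]
    have key := res_add_res_eq_zero_of_cechD1_eq_zero f U c hc i j
    apply resΓ_injective_of_ge (le_inf (inf_le_left.trans inf_le_right) inf_le_right : U j ⊓ U i ⊓ U j ≤ U i ⊓ U j)
      (le_inf (le_inf inf_le_right inf_le_left) inf_le_right)
    change Sections.res f _ (-Sections.res f _ (Sections.res f _ (c j i))) = Sections.res f _ (c i j)
    rw [map_neg, Sections.res_res, Sections.res_res, eq_comm, ← sub_eq_zero, sub_neg_eq_add]
    exact key

end Extend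

end Literature.AlgebraicGeometry.Modules

end
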